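import Literature.NumberTheory.Automorphic.Liu2021.AppendixC.DefC1toC3
import Literature.NumberTheory.Automorphic.UnitaryGroupFormTransport
import Literature.AlgebraicGeometry.ShimuraVarieties.KudlaRapoport2013.Sec4RelationToShimuraVarieties
import Literature.AlgebraicGeometry.ShimuraVarieties.KudlaRapoport2013.Sec2Defs
import Mathlib.CategoryTheory.Groupoid
import Mathlib.RingTheory.ClassGroup.Basic
import Mathlib.RingTheory.FractionalIdeal.Norm
import Mathlib.NumberTheory.NumberField.Completion.FinitePlace
import HarnessLib

/-!
# Kudla–Rapoport, *Special cycles on unitary Shimura varieties II: global theory*, §3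
# «Uniformization of the complex points» (arXiv v2 pp. 15–19) — SECTION CARPET (statements only, no proof)

[KudlaRapoport2013] = S. Kudla, M. Rapoport, *Special cycles on unitary Shimura varieties II: global theory*,
J. reine angew. Math. **697** (2014) 91–157 = arXiv:0912.3758.  VERSION OF RECORD for numbering and pages (squad
ruling R-1): arXiv **v2** (18 Dec 2012, «accepted for publication in Crelle»), cited as «(arXiv v2 p. N)»; the
text was read on the squad's page-faithful extraction of the v2 PDF (`T/KR/TKR-t02/g0/KR2013-arXivv2-pages.txt`,
sha16 5ca9342435eb98df, blocks «arXiv v2 page N») with every displayed formula re-derived from the held TeX of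
arXiv v1 (`paper:arxiv-0912.3758`, chunks p0011–p0013).  CONCORDANCE v1 ↔ v2 for §3: identical numbering and
wording (Prop. 3.1, Cor. 3.2, Rem. 3.3, Rem. 3.4, Prop. 3.5, Cor. 3.6, Rem. 3.7, Prop. 3.8; displays (3.1)–(3.5));
v1 pages 21–24, v2 pages 15–19; the only textual deltas are v2's «Here `√Δ ∈ k` is the element for which `τ(√Δ)` has
positive imaginary part» (p. 15) and «the inverse of the exponential map» (p. 16).  The tree's older tags
«KudlaRapoport2013, §4.1 (arXiv p. 14)» refer to the v1 TeX CHUNK 14, not to a page of either version.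

## What this file is

The squad-TKR carpet of §3 (seat plan «GO 500», deal sheet `SPLIT-TKR.v1` row TKR-t03): every numbered item of
§3 and the displays (3.1)–(3.5) typed AS PRINTED, over REAL objects wherever Mathlib / the tree has them, and over
⟨CARRIER⟩ data only for the complex points of the moduli stacks `M(n−r,r)`, `M₀`, `Z(T)` of §2 (whose objects —
triples `(A, ι, λ)` over `Spec ℂ` — are the squad's ★ `KudlaRapoport2013.Sec2Defs` objects, not re-declared here;
ED. 2 instantiates the carriers by them: `Sec3Data.ofSec2`, see «ED. 2» below).
Dedup census (2026-09-02): no tree declaration carries a `[cite: KudlaRapoport2013, §3 …]` tag; the notions of §3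
that the tree HAS are used by name: hermitian spaces over the CM field `k` = ★ `Liu2021.AppendixC.HermSpace ℚ k`
(its `gram` is the matrix `J` below), the nontrivial automorphism `σ` of `k` = ★ `Liu2021.AppendixC.conj ℚ k`, the
isometry group `U(V)(ℚ)` = ★ `unitaryGroupOfForm σ J`, change of basis of a form = ★ `formCongr`, the finite-adelic
points `G₁^V(𝔸_f) = U(V)(𝔸_f)` = ★ `UnitaryGroup.finAdelic ℚ k (conj ℚ k) n J`, the ideal class group `C(k)` = Mathlib
`ClassGroup (𝓞 k)`, the norm of a fractional ideal = Mathlib `FractionalIdeal.absNorm`, groupoids = Mathlib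
`CategoryTheory.Groupoid`.

## Conventions (READINGS, stated once)

* R0 (coordinates).  KR's hermitian space `V, ( , )` of dimension `n` over `k` is taken in coordinates `V = kⁿ`
  with Gram matrix `J` (`J i j = (e_j, e_i)`, the convention of ★ `HermSpace.gram`), so that KR's form — `k`-linear in
  the FIRST and `σ`-antilinear in the SECOND variable (§2.2: `h'(x, y) = λ₀⁻¹ ∘ y^∨ ∘ λ ∘ x`) — is
  `krForm σ J u v = Σ_{i,j} σ(v_i) J_{ij} u_j`.  Every `V : HermSpace ℚ k` is of this form through `V.basis`/`V.gram`;
  letting `J` range over all hermitian matrices ranges over all hermitian spaces of dimension `n` (up to isometry,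
  with repetitions), which is how the index sets `𝓛_{(n−r,r)}(k)`, `𝓡_{(n−r,r)}(k)♯` of §§2.4, 3.2 are realised below
  without choosing representatives.  `V₀` (dimension 1) is `Fin 1 → k`, and `Ṽ = Hom_k(V₀, V)` is `Matrix (Fin n) (Fin 1) k`.
* R1 (the complex structure).  With the embedding `τ : k → ℂ` fixed in §3 (p. 15) and `τ(√Δ)` of positive imaginary
  part, `k ⊗_ℚ ℝ = ℂ` via `τ` and `(V_ℝ, J₀)`, `J₀ = √Δ ⊗ |Δ|^{−1/2}`, IS the complex vector space `V ⊗_{k,τ} ℂ = ℂⁿ`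
  (`J₀` acts as `τ(√Δ)|Δ|^{−1/2} = i`); «complex `r`-plane in `(V_ℝ, J₀)`» = `ℂ`-subspace of `ℂⁿ` of dimension `r`,
  and `( , )` extends to the complex hermitian form with Gram matrix `J.map τ`.
* R2 («isomorphism of orbifolds»).  An orbifold `[Γ∖D]`, and more generally the right-hand sides of Prop. 3.1,
  Cor. 3.2, Prop. 3.5, Prop. 3.8, are read as GROUPOIDS (objects = points, morphisms `x → y` = group elements `g`
  with `g·x = y`); the complex points `M(n−r,r)(ℂ)` etc. are the groupoids of §2.1 (objects `(A, ι, λ)` over `ℂ`,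
  morphisms the `O_k`-linear isomorphisms respecting `λ`).  «Isomorphism of orbifolds» is typed as an EQUIVALENCE of
  these groupoids (`IsGroupoidEquivOfAction`: a functor to the transport groupoid that is faithful, full and
  essentially surjective).  The complex-analytic structure of either side is NOT typed.  A coproduct
  `∐_{[L] ∈ 𝓛} [Γ_L∖D(L)]` over isomorphism-class representatives IS (canonically equivalent to) the transport groupoid
  whose objects are ALL pairs `(L, z)` and whose morphisms are all isometries — this is the form typed (no
  representatives are chosen; see `LatticePoint`, `CyclePoint`, `AdelicPoint`, `AdelicCyclePoint`).
* R3 (`G₁(𝔸_f)/K₁` as adelic lattices).  For a self-dual lattice `L`, `L ⊗ Ẑ` is the closure `L̂` of `L` in `𝔸ⁿ_{k,f}`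
  (`adelicLattice`), `K₁^{V♯}` is its stabiliser in `G₁^V(𝔸_f)`, and `g K₁ ↦ g L̂` identifies `G₁^V(𝔸_f)/K₁^{V♯}` with the
  `G₁^V(𝔸_f)`-orbit (= genus) of `L̂`; cosets are typed as these adelic lattices.

Every `def … : Prop` named `KR2013_3_…` is either a CLOSED statement (true as written, hypotheses complete) or a
PREDICATE on the consumer's datum `D : Sec3Data k` (the carriers); `∀ D, P D` is never claimed.  NO PROOF, no
`sorry`, no `axiom`, no `instance`, no `notation`.

## INDEX — every item of §3 ↦ declaration (all in this file unless marked ★)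

* §3 preamble (p. 15 «we fix an embedding `τ` of `k` into `ℂ`») ↦ field `Sec3Data.τ`.
* §3.1 (pp. 15–16): `G = GU(V)`, `G(R) = {g ∈ End_k(V) ⊗ R | g g* = ν(g) ∈ R^×}` ↦ ★ `Sec4RelationToShimuraVarieties.GU` (the
  squad's §4 file); `G₁ = U(V)` ↦ ★ `unitaryGroupOfForm`; «`ν(G(ℝ)) = ℝ^×` for signature `(r,r)`, `ℝ^×_+` for `r ≠ n−r`» ↦ `KR2013_3_1_nuRealRange` (CLOSED);
  `D = D(V)` = negative `r`-planes in `(V_ℝ, J₀)` ↦ `negPlanes`; signature `(r,r)`: `D = D⁺ ∪ D⁻` ↦ `signedNegPlanes`;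
  signature `(n−r, r)` at `τ` ↦ `HasSignatureAt` (Sylvester normal form `signDiag`).
* §3.2 (pp. 16–17): `𝓛_{(n−r,r)}(k)` ↦ `IsSelfDualHermLattice` on `LatticeDatum` (with `IsHermitianFor`, `IsFullLattice`,
  `IsSelfDualFor`); `Γ_L` ↦ `isometryStabilizer`; **Proposition 3.1** ↦ `KR2013_3_1` (predicate; transport groupoid
  `LatticePoint`/`LatticePoint.Moves`); `L_{0,𝔞}`, `V_{0,𝔞}` ↦ `idealGram`, `idealLattice`; **(3.1)** `C(k) ≅ 𝓛_{(1,0)}(k)`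
  ↦ `KR2013_3_eq_3_1` (CLOSED, three clauses); **(3.2)** `M₀(ℂ) ≅ [O_k^×∖C(k)]` ↦ `KR2013_3_eq_3_2` (predicate);
  «the fiber in `𝓛` over `(V, [[L]])` is in bijection with `G₁(ℚ)∖G₁(𝔸_f)/K₁`» ↦ `adelicLattice`, `glImage`,
  `KR2013_3_2_fibre` (CLOSED); **Corollary 3.2** ↦ `KR2013_3_2` (predicate; `AdelicPoint`); **Remark 3.3** ↦
  `KR2013_3_3` (CLOSED: the fibres of `C(k) ≅ 𝓛_{(1,0)} → 𝓡_{(1,0)}` are the cosets of `C(k)²`; the last sentence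
  `G₁^{V₀}(ℚ)∖G₁^{V₀}(𝔸_f)/K₁^{V₀} = k¹∖k¹_{𝔸_f}/Ô¹_k = C(k)²` is RECORDED in its docstring, not typed); **Remark 3.4** ↦
  RECORDED only (docstring of `KR2013_3_2`): it refers to the summands `M^{Ṽ}` of Prop. 2.12, a §2 carrier.
* §3.3 (pp. 17–19): `L̃ = Hom_{O_k}(L₀, L)`, `h̃` ↦ `homLattice`, `hTilde`; incidence (1), (2), `D(L)_x̃`,
  `Inc_∞(T; L, L₀)` ↦ `negPlanesPerp`, `incInfty`; **Proposition 3.5** ↦ `KR2013_3_5` (predicate; `CyclePoint`);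
  **(3.3)** `L_𝔞` ↦ `twistGram`, `twistLattice`; **(3.4)** ↦ `KR2013_3_eq_3_4` (CLOSED); **(3.5)** ↦ READING in the
  docstring of `KR2013_3_5` (same groupoid, objects re-indexed by `[𝔞] ∈ C(k)` through (3.4)); the sentence «if
  `h̃(x̃, x̃) = T > 0` then `m ≤ n−r` and `D(L)_x̃` has codimension `mr`» ↦ `KR2013_3_6_pre` (CLOSED: `m ≤ n − r`; the
  codimension clause RECORDED); **Corollary 3.6** ↦ `KR2013_3_6` (predicate, with the CLOSED companion
  `KR2013_3_6_empty`: `Inc_∞ = ∅` for `m > n − r`); **Remark 3.7** (Kudla–Millson cycles `Z(T; L_𝔞, Γ_L)`) ↦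
  `kmCycle`; adelic incidence (0)–(2), `Inc_∞(T; V♯, V₀)` ↦ `AdelicCyclePoint`; **Proposition 3.8** ↦ `KR2013_3_8`.
* ED. 2 bridge to ★ `Sec2Defs` (§2.1 p. 8, §2.2 Def. 2.8, §2.4 p. 10): `specOfEmbedding`, `Sec3Data.ofSec2`,
  `Sec3Data.GroupoidMatchesIso` / `GroupoidMatchesIso₀` / `GroupoidMatchesIsoZ`, `SelfDualLattice.coords`,
  `SelfDualLattice.toLatticeDatum`, `krForm_eq_hermForm`.

## ED. 2 (2026-09-02; squad rulings R-8a Plan A, R-9a; QA box T-ref6 N1)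

Purely additive with respect to ED. 1 (★ p848165): no declaration of ED. 1 changes statement or meaning.  (i) The file
now imports the squad's §2 file ★ `KudlaRapoport2013.Sec2Defs` (import order of record §2 → §3) and HOSTS THE BRIDGE
between its basis-free self-dual lattices ★ `Sec2Defs.SelfDualLattice k V` (`V` = ★ `HermSpace ℚ k`) and this file's
coordinate dress: `SelfDualLattice.coords`, `SelfDualLattice.toLatticeDatum` — moved verbatim (up to the namespace:
`L.coords` ↦ `SelfDualLattice.coords L`) from `Sec2Defs` ED. v2 (p848315), where the p848160 review had requested them,
so that `Sec2Defs` ED. v3 (★ p848365) no longer imports this file.  (ii) `specOfEmbedding τ : Spec ℂ ⟶ Spec O_k` and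
`Sec3Data.ofSec2 C τ : Sec3Data k` INSTANTIATE the ⟨CARRIER⟩ fields `MC`, `M0C`, `ZC` of ED. 1 by the REAL objects
★ `Sec2Core.Obj`, ★ `Sec2Core.M0Obj`, ★ `Sec2Core.ZObj` of `Sec2Defs` over `Spec ℂ` (so every row `KR2013_3_… D` is
available verbatim on them as `KR2013_3_… (Sec3Data.ofSec2 C τ)`; a field SWAP was not possible without breaking the
landed §13 file, whose `Sec13Data : Type (u+1) extends Sec3Data.{u} k`), and `Sec3Data.GroupoidMatchesIso`,
`Sec3Data.GroupoidMatchesIso₀`, `Sec3Data.GroupoidMatchesIsoZ` say that the consumer's `[Groupoid _]` structures on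
them have exactly the printed isomorphisms ★ `NaiveObj.Iso`, ★ `M0Obj.Iso`, ★ `ZObj.Iso` (§2.1 p. 8, Def. 2.8).
(iii) `krForm_eq_hermForm`: `krForm σ J u v = hermForm σ J v u` (★ `ShimuraVarieties.hermForm`, by `rfl`; T-ref6 N1,
ruling R-9a «tree-provable ⇒ theorem»).

## References

* [KudlaRapoport2013] S. Kudla, M. Rapoport, *Special cycles on unitary Shimura varieties II: global theory*,
  J. reine angew. Math. 697 (2014) 91–157; arXiv:0912.3758v2, §3 pp. 15–19 (§2.1 p. 7, §2.2 p. 9, §2.4 pp. 11–13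
  for the standing notions).
* [KudlaMillson1990] S. Kudla, J. Millson, *Intersection numbers of cycles on locally symmetric spaces and Fourier
  coefficients of holomorphic modular forms in several complex variables*, Publ. Math. IHÉS 71 (1990) — the cycles
  of Remark 3.7 (KR's refs. [33], [34], [35], and [28] for signature `(2,1)`).
* [Liu2021] Y. Liu, *Fourier–Jacobi cycles and arithmetic relative trace formula*, Camb. J. Math. 9 (2021), App. C
  (the tree's `HermSpace`, `conj`, `UnitaryGroup.finAdelic`).
-/

noncomputable section

open NumberField CategoryTheory Matrix
open scoped nonZeroDivisors ComplexOrder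

namespace Literature.AlgebraicGeometry.ShimuraVarieties.KudlaRapoport2013.Sec3ComplexUniformization

open Literature.NumberTheory.Automorphic (unitaryGroupOfForm formCongr)
open Literature.NumberTheory.Automorphic.Liu2021.AppendixC (conj)

universe u v

/-! ## §3.1 (arXiv v2 pp. 15–16): `GU(V)`, `ν(G(ℝ))`, the space `D(V)` of negative `r`-planes -/

section Forms

variable {R : Type*} [CommRing R] {n : ℕ}

/-- **KR's hermitian form in coordinates** (READING R0): for a Gram matrix `J` and an involution `σ`,
`krForm σ J u v = Σ_{i,j} σ(v_i) J_{ij} u_j = σ(v)ᵀ J u` — `R`-linear in the FIRST variable `u` and `σ`-antilinear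
in the SECOND variable `v`, as KR's `( , )` and `h'(x, y) = λ₀⁻¹ ∘ y^∨ ∘ λ ∘ x` (§2.2, arXiv v2 p. 9); it is the
tree's `ShimuraVarieties.hermForm σ J v u` with the arguments swapped. [cite: KudlaRapoport2013, §2.2 and §3.1 (arXiv v2 pp. 9, 15)] -/
def krForm (σ : R →+* R) (J : Matrix (Fin n) (Fin n) R) (u v : Fin n → R) : R :=
  (σ ∘ v) ⬝ᵥ (J *ᵥ u)

/-- `J` is the Gram matrix of a HERMITIAN form for the involution `σ`: `σ(J_{ij}) = J_{ji}`, i.e.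
`(y, x) = σ((x, y))` («hermitian vector space over `k`», §3.1 p. 15; ★ `HermSpace.form_herm` in coordinates).
[cite: KudlaRapoport2013, §3.1 (arXiv v2 p. 15)] -/
def IsHermitianFor (σ : R →+* R) (J : Matrix (Fin n) (Fin n) R) : Prop :=
  ∀ i j, σ (J i j) = J j i

-- §3.1, p. 15: «`G(R) = {g ∈ End_k(V) ⊗_ℚ R | g g* = ν(g) ∈ R^×}`» = ★ `KudlaRapoport2013.Sec4RelationToShimuraVarieties.GU σ J`
-- (the squad's §4 file, same coordinates: the graph `{(g, ν)}` of the multiplier), and `G₁ = U(V)` = ★ `unitaryGroupOfForm σ J`;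
-- neither is restated here.

end Forms

/-- The diagonal Gram matrix `diag(1, …, 1, −1, …, −1)` with `n − r` entries `1` followed by `r` entries `−1`: the
Sylvester normal form of a complex hermitian form of signature `(n−r, r)` («hermitian vector space over `k` of
signature `(n−r, r)`», §3.1 p. 15). [cite: KudlaRapoport2013, §3.1 (arXiv v2 p. 15)] -/
def signDiag (n r : ℕ) : Matrix (Fin n) (Fin n) ℂ :=
  Matrix.diagonal fun i => if (i : ℕ) < n - r then 1 else -1

/-- **Signature `(n−r, r)` at the complex embedding `τ`** of the hermitian Gram matrix `J` over `k`: the complex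
hermitian matrix `J^τ = J.map τ` (Gram matrix of `V ⊗_{k,τ} ℂ`, READING R1) is congruent to `signDiag n r`,
`Tᴴ J^τ T = diag(1^{n−r}, (−1)^r)` for some `T ∈ GL_n(ℂ)` (Sylvester).  The abstract counterpart for `V : HermSpace ℚ k` is
★ `HermSpace.sig`. [cite: KudlaRapoport2013, §3.1 (arXiv v2 p. 15)] -/
def HasSignatureAt {k : Type*} [Field k] {n : ℕ} (τ : k →+* ℂ) (J : Matrix (Fin n) (Fin n) k) (r : ℕ) : Prop :=
  ∃ T : GL (Fin n) ℂ, (T : Matrix (Fin n) (Fin n) ℂ)ᴴ * J.map τ * (T : Matrix (Fin n) (Fin n) ℂ) = signDiag n r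

/-- **[KR2013 §3.1, the display on p. 15] CLOSED.**  «We note that `ν(G(ℝ)) = ℝ^×` for signature `(r, r)`, and
`= ℝ^×_+` for signature `(n−r, r)` with `r ≠ n−r`.  This fact distinguishes the case `n−r ≠ r` from the case `n−r = r`.»
TYPED on the Sylvester normal form (READING R1: `G(ℝ)` = the complex similitudes of `J^τ ≃ signDiag n r`, conjugate
by `T`): for `1 ≤ n` (standing hypothesis `n ≥ 1` of §2.1) and `r ≤ n`, the set of real multipliers
`{c ∈ ℝ | ∃ g ∈ GL_n(ℂ), gᴴ · signDiag n r · g = c · signDiag n r}` equals `{c | c ≠ 0}` if `r = n − r` and `{c | 0 < c}`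
if `r ≠ n − r`. [cite: KudlaRapoport2013, §3.1 (arXiv v2 p. 15)] -/
def KR2013_3_1_nuRealRange : Prop :=
  ∀ n r : ℕ, 1 ≤ n → r ≤ n →
    let S : Set ℝ := {c | ∃ g : GL (Fin n) ℂ,
      (g : Matrix (Fin n) (Fin n) ℂ)ᴴ * signDiag n r * (g : Matrix (Fin n) (Fin n) ℂ) = (c : ℂ) • signDiag n r}
    (r = n - r → S = {c | c ≠ 0}) ∧ (r ≠ n - r → S = Set.Ioi 0)

section Planes

variable {n : ℕ}

/-- The complex hermitian pairing `⟨u, w⟩ = Σ conj(w_i) (J^τ)_{ij} u_j` on `V ⊗_{k,τ} ℂ = ℂⁿ` (READING R1), linear in `u`: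
`krForm` for complex conjugation. [cite: KudlaRapoport2013, §3.1 (arXiv v2 p. 15)] -/
def krFormC (Jc : Matrix (Fin n) (Fin n) ℂ) (u w : Fin n → ℂ) : ℂ :=
  krForm (starRingEnd ℂ) Jc u w

/-- **`D = D(V)`, the space of negative `r`-planes in `(V_ℝ, J₀)`** (§3.1, p. 16: «we can identify the space of
homomorphisms `h : 𝕊 → G(ℝ)` of the above type with the space `D = D(V)` of negative `r`-planes in `(V_ℝ, J₀)`»;
«`U` is a complex `r`-plane in `(V_ℝ, J₀)` on which the hermitian form `( , )` is negative definite», p. 15), for the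
complex Gram matrix `Jc = J^τ` (READING R1: complex `r`-planes in `(V_ℝ, J₀)` = `ℂ`-subspaces of `ℂⁿ` of dimension `r`).
The identification `h ↦ U = {h(i) = −J₀}` with the homomorphisms `h` is not typed (prose of p. 15).
[cite: KudlaRapoport2013, §3.1 (arXiv v2 pp. 15–16)] -/
def negPlanes (r : ℕ) (Jc : Matrix (Fin n) (Fin n) ℂ) : Set (Submodule ℂ (Fin n → ℂ)) :=
  {U | Module.finrank ℂ U = r ∧ ∀ x ∈ U, x ≠ 0 → (krFormC Jc x x).re < 0}

/-- **Signature `(r, r)`: `D = D⁺ ∪ D⁻`, where `D^ε` is the space of `r`-planes that are negative for `ε( , )`**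
(§3.1, p. 16), `ε = ±1` given as a sign `ε : ℤˣ`. [cite: KudlaRapoport2013, §3.1 (arXiv v2 p. 16)] -/
def signedNegPlanes (r : ℕ) (ε : ℤˣ) (Jc : Matrix (Fin n) (Fin n) ℂ) : Set (Submodule ℂ (Fin n → ℂ)) :=
  negPlanes r (((ε : ℤ) : ℂ) • Jc)

/-- The action of `g ∈ GL_n(k)` on complex `r`-planes through `τ` (`z ↦ g z` in `V ⊗_{k,τ} ℂ`), used for `Γ_L∖D(L)` and
`G₁(ℚ)∖D(V)`. [cite: KudlaRapoport2013, §3.2 (arXiv v2 p. 16)] -/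
def planeImage {k : Type*} [Field k] (τ : k →+* ℂ) (g : GL (Fin n) k) (z : Submodule ℂ (Fin n → ℂ)) :
    Submodule ℂ (Fin n → ℂ) :=
  z.map (Matrix.toLin' ((g : Matrix (Fin n) (Fin n) k).map τ))

end Planes

/-! ## §3.2 (arXiv v2 pp. 16–17): self-dual hermitian lattices, `𝓛_{(n−r,r)}(k)`, Proposition 3.1 -/

section Lattices

variable {k : Type} [Field k] [NumberField k] {n : ℕ}

/-- `L ⊆ kⁿ` is an **`O_k`-lattice** (of rank `n`): a finitely generated `O_k`-submodule spanning `kⁿ` over `k`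
(«`H` is an `O_k`-lattice of rank `n`», §3.2 p. 16). [cite: KudlaRapoport2013, §3.2 (arXiv v2 p. 16)] -/
def IsFullLattice (L : Submodule (𝓞 k) (Fin n → k)) : Prop :=
  L.FG ∧ Submodule.span k (L : Set (Fin n → k)) = ⊤

/-- `L` is **self-dual** for the hermitian form `( , )` with Gram matrix `J`: `L = L^∨ := {x ∈ V | (x, L) ⊆ O_k}`
(«the `O_k`-lattice `H` is self dual with respect to `( , )_{λ,k}`», §3.2 p. 16; «self-dual hermitian `O_k`-lattices»,
§2.4 p. 11). [cite: KudlaRapoport2013, §3.2 (arXiv v2 p. 16)] -/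
def IsSelfDualFor (σ : k →+* k) (J : Matrix (Fin n) (Fin n) k) (L : Submodule (𝓞 k) (Fin n → k)) : Prop :=
  ∀ x : Fin n → k, x ∈ L ↔ ∀ y ∈ L, krForm σ J x y ∈ (algebraMap (𝓞 k) k).range

/-- A hermitian `O_k`-lattice in coordinates (READING R0): a Gram matrix `J` on `V = kⁿ` together with an
`O_k`-submodule `L ⊆ kⁿ` — the objects whose isomorphism classes form `𝓛_{(n−r,r)}(k)` (§3.2 p. 16) once the conditions
`IsSelfDualHermLattice` are imposed. [cite: KudlaRapoport2013, §3.2 (arXiv v2 p. 16)] -/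
structure LatticeDatum (k : Type) [Field k] [NumberField k] (n : ℕ) : Type where
  /-- the Gram matrix `J` of `V = L ⊗ ℚ = kⁿ` -/
  J : Matrix (Fin n) (Fin n) k
  /-- the `O_k`-module `L ⊆ kⁿ` -/
  L : Submodule (𝓞 k) (Fin n → k)

/-- **`𝓛_{(n−r,r)}(k)`, «the set of isomorphism classes of self-dual hermitian `O_k`-lattices of signature `(n−r, r)`»**
(§3.2 p. 16), as the defining predicate on `LatticeDatum`s: `J` hermitian for `σ`, of signature `(n−r, r)` at `τ`, `L` a
full `O_k`-lattice, self-dual for `J`.  Isomorphism = transport by `GL_n(k)` (`LatticePoint.Moves` with the plane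
ignored); no representatives are chosen (READING R0/R2). [cite: KudlaRapoport2013, §3.2 (arXiv v2 p. 16)] -/
def IsSelfDualHermLattice (σ : k →+* k) (τ : k →+* ℂ) (r : ℕ) (X : LatticeDatum k n) : Prop :=
  IsHermitianFor σ X.J ∧ HasSignatureAt τ X.J r ∧ IsFullLattice X.L ∧ IsSelfDualFor σ X.J X.L

/-- **`Γ_L`, «the group of isometries of `L`»** (§3.2 p. 16): the `γ ∈ U(V)(ℚ) =` ★ `unitaryGroupOfForm σ J` with
`γ L = L` (typed as `γ L ⊆ L ∧ γ⁻¹ L ⊆ L`). [cite: KudlaRapoport2013, §3.2 (arXiv v2 p. 16)] -/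
def isometryStabilizer (σ : k →+* k) (X : LatticeDatum k n) : Set (GL (Fin n) k) :=
  {γ | γ ∈ unitaryGroupOfForm σ X.J ∧ (∀ x ∈ X.L, (γ : Matrix (Fin n) (Fin n) k) *ᵥ x ∈ X.L) ∧
    ∀ x ∈ X.L, ((γ⁻¹ : GL (Fin n) k) : Matrix (Fin n) (Fin n) k) *ᵥ x ∈ X.L}

/-- The image `g L` of an `O_k`-submodule `L ⊆ kⁿ` under `g ∈ GL_n(k)`. [cite: KudlaRapoport2013, §3.2 (arXiv v2 p. 16)] -/
def latticeImage (g : GL (Fin n) k) (L : Submodule (𝓞 k) (Fin n → k)) : Submodule (𝓞 k) (Fin n → k) :=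
  L.map ((Matrix.toLin' (g : Matrix (Fin n) (Fin n) k)).restrictScalars (𝓞 k))

end Lattices

/-- **«Isomorphism of orbifolds» as an equivalence of groupoids** (READING R2).  `C` is a groupoid (the complex
points of a moduli stack); the target is the TRANSPORT GROUPOID of a type of points `X` under a group `G`, presented
by the relation `moves g x y` («`g` carries `x` to `y`»; objects `X`, morphisms `x → y` the `g` with `moves g x y`,
composition = multiplication) — for `X = D(L)`-points and `G ⊇ Γ_L` this is the orbifold `[Γ_L∖D(L)]`.  The predicate:
there is a functor `(F, φ)` from `C` to the transport groupoid (`φ` multiplicative on composites, `φ(𝟙) = 1`, `φ f`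
carries `F a` to `F b`) which is faithful, full, and essentially surjective — i.e. an equivalence of groupoids.
[cite: KudlaRapoport2013, §3.2 Prop. 3.1 (arXiv v2 p. 16)] -/
def IsGroupoidEquivOfAction (C : Type u) [Groupoid.{v} C] {G : Type*} [Group G] {X : Type*}
    (moves : G → X → X → Prop) : Prop :=
  ∃ (F : C → X) (φ : ∀ ⦃a b : C⦄, (a ⟶ b) → G),
    (∀ a : C, φ (𝟙 a) = 1) ∧
    (∀ ⦃a b c : C⦄ (f : a ⟶ b) (g : b ⟶ c), φ (f ≫ g) = φ g * φ f) ∧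
    (∀ ⦃a b : C⦄ (f : a ⟶ b), moves (φ f) (F a) (F b)) ∧
    (∀ ⦃a b : C⦄ (f f' : a ⟶ b), φ f = φ f' → f = f') ∧
    (∀ (a b : C) (g : G), moves g (F a) (F b) → ∃ f : a ⟶ b, φ f = g) ∧
    (∀ x : X, ∃ (a : C) (g : G), moves g (F a) x)

section Standing

variable (k : Type) [Field k] [NumberField k] [IsTotallyComplex k] [Algebra.IsQuadraticExtension ℚ k]

/-- **Standing data of §3** over the imaginary-quadratic field `k` (a CM field with `F = ℚ`: the instance
hypotheses; its nontrivial automorphism is `σ = conj ℚ k`, §2.1): the embedding «we fix an embedding `τ` of `k` into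
`ℂ`» (p. 15), the integers `n ≥ 1`, `0 ≤ r ≤ n` of §2.1 (p. 7), and ⟨CARRIER⟩ types of complex points — `MC` = the objects
`(A, ι, λ)` of `M(n−r, r)` over `Spec ℂ` (§2.1), `M0C` = the objects `(E, ι₀, λ₀)` of `M₀ = M(1,0)` over `Spec ℂ` (Ex. 2.2),
`ZC m T` = the objects `(A, ι, λ, E, ι₀, λ₀; x)` of `Z(T)` over `Spec ℂ` for `T ∈ Herm_m(O_k)` (Def. 2.8) — whose
GROUPOID structures (isomorphisms of such tuples) are supplied by the consumer as `[Groupoid D.MC]` etc. (only the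
TYPE of objects is posited here; ED. 2: `Sec3Data.ofSec2 C τ` INSTANTIATES the three carriers by the squad's ★
`KudlaRapoport2013.Sec2Defs` objects `Sec2Core.Obj`, `Sec2Core.M0Obj`, `Sec2Core.ZObj` over `Spec ℂ → Spec O_k` induced
by `τ`, and `Sec3Data.GroupoidMatchesIso` records that the consumer's groupoid has the printed isomorphisms).  Nothing
is asserted. [cite: KudlaRapoport2013, §3 (arXiv v2 p. 15)] -/
structure Sec3Data : Type (u + 1) where
  /-- «we fix an embedding `τ` of `k` into `ℂ`» (§3, p. 15). REAL. -/
  τ : k →+* ℂ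
  /-- `n ≥ 1` (§2.1, p. 7). -/
  n : ℕ
  /-- `0 ≤ r ≤ n` (§2.1, p. 7). -/
  r : ℕ
  one_le_n : 1 ≤ n
  r_le_n : r ≤ n
  /-- ⟨CARRIER⟩ the objects of the groupoid `M(n−r, r)(ℂ)`: triples `(A, ι, λ)` over `ℂ` (§2.1). -/
  MC : Type u
  /-- ⟨CARRIER⟩ the objects of the groupoid `M₀(ℂ) = M(1, 0)(ℂ)`: CM elliptic curves `(E, ι₀, λ₀)` over `ℂ` (Ex. 2.2). -/
  M0C : Type u
  /-- ⟨CARRIER⟩ the objects of the groupoid `Z(T)(ℂ)`, `T ∈ Herm_m(O_k)` (Def. 2.8; `T` given as a matrix over `k`). -/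
  ZC : (m : ℕ) → Matrix (Fin m) (Fin m) k → Type u

end Standing

section Sec32

variable {k : Type} [Field k] [NumberField k] [IsTotallyComplex k] [Algebra.IsQuadraticExtension ℚ k]

/-- The objects of the transport groupoid `∐_{[L] ∈ 𝓛_{(n−r,r)}(k)} [Γ_L∖D(L)]` (READING R2): a self-dual hermitian
lattice `(J, L)` of signature `(n−r, r)` together with a point `z ∈ D(L) = D(L ⊗ ℚ)` (§3.2 p. 16: «`D(L) = D(L ⊗ ℚ)` for
the corresponding space of negative `r`-planes»). [cite: KudlaRapoport2013, §3.2 Prop. 3.1 (arXiv v2 p. 16)] -/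
structure LatticePoint (D : Sec3Data.{u} k) : Type where
  /-- the hermitian lattice `(J, L)` -/
  X : LatticeDatum k D.n
  /-- the negative `r`-plane `z` -/
  z : Submodule ℂ (Fin D.n → ℂ)
  isLattice : IsSelfDualHermLattice (conj ℚ k : k →+* k) D.τ D.r X
  mem_negPlanes : z ∈ negPlanes D.r (X.J.map D.τ)

/-- `g ∈ GL_n(k)` carries `(J, L, z)` to `(J', L', z')`: `g` is an isometry `(kⁿ, J) → (kⁿ, J')` (`σ(g)ᵀ J' g = J`, ★
`formCongr`), `g L = L'`, `g z = z'`.  Between points with the same `(J, L)` these are exactly the `γ ∈ Γ_L` with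
`γ z = z'` («any two choices of `j` differ by an element of `Γ_L`», p. 16). [cite: KudlaRapoport2013, §3.2 Prop. 3.1 (arXiv v2 p. 16)] -/
def LatticePoint.Moves {D : Sec3Data.{u} k} (g : GL (Fin D.n) k) (P Q : LatticePoint D) : Prop :=
  formCongr (conj ℚ k : k →+* k) g Q.X.J = P.X.J ∧ Q.X.L = latticeImage g P.X.L ∧ Q.z = planeImage D.τ g P.z

/-- **[KR2013, Proposition 3.1] AS PRINTED** (§3.2, arXiv v2 p. 16), for the datum `D` and the consumer's groupoid
structure on `D.MC = M(n−r, r)(ℂ)`: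

«There is an isomorphism of orbifolds `M(n−r, r)(ℂ) ≅ ∐_L [Γ_L∖D(L)]`, where `L` runs over `𝓛_{(n−r,r)}(k)`.»

TYPED (READINGS R0–R2): the groupoid `M(n−r,r)(ℂ)` is equivalent to the transport groupoid of `LatticePoint D` under
`GL_n(k)` (objects `(L, z)` with `L` a self-dual hermitian `O_k`-lattice of signature `(n−r, r)` and `z ∈ D(L)`,
morphisms the isometries — whose components are the `[Γ_L∖D(L)]`, `[L] ∈ 𝓛_{(n−r,r)}(k)`).  The printed construction
of the map (`H = H₁(A, ℤ)` with `( , )_{λ,k}`, `⟨x, y⟩_λ = tr((x, y)/√Δ)`, `H_ℝ = Lie A`) is not typed.  A consumer takes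
`(h : KR2013_3_1 D)` for ITS OWN `D` and groupoid instance. NO PROOF. [cite: KudlaRapoport2013, §3.2 Prop. 3.1 (arXiv v2 p. 16)] -/
def KR2013_3_1 (D : Sec3Data.{u} k) [Groupoid.{v} D.MC] : Prop :=
  IsGroupoidEquivOfAction D.MC (G := GL (Fin D.n) k) (LatticePoint.Moves (D := D))

/-- **`V_{0,𝔞} = k` with the hermitian form `(x, y) = N(𝔞)⁻¹ x y^σ`** (§3.2 p. 16), as a `1 × 1` Gram matrix on
`V₀ = Fin 1 → k` (READING R0), for an invertible fractional ideal `𝔞` of `k`; `N(𝔞)` = Mathlib `FractionalIdeal.absNorm`.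
[cite: KudlaRapoport2013, §3.2 (3.1) (arXiv v2 p. 16)] -/
def idealGram (𝔞 : (FractionalIdeal (𝓞 k)⁰ k)ˣ) : Matrix (Fin 1) (Fin 1) k :=
  Matrix.of fun _ _ => algebraMap ℚ k (FractionalIdeal.absNorm (𝔞 : FractionalIdeal (𝓞 k)⁰ k))⁻¹

/-- **`L_{0,𝔞}`: the fractional ideal `𝔞 ⊆ k = V_{0,𝔞}`** as an `O_k`-submodule of `Fin 1 → k` («a fractional ideal `𝔞`
defines a self-dual hermitian lattice `L_{0,𝔞}` in the space `V_{0,𝔞} = k`», §3.2 p. 16).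
[cite: KudlaRapoport2013, §3.2 (3.1) (arXiv v2 p. 16)] -/
def idealLattice (𝔞 : (FractionalIdeal (𝓞 k)⁰ k)ˣ) : Submodule (𝓞 k) (Fin 1 → k) :=
  ((𝔞 : FractionalIdeal (𝓞 k)⁰ k) : Submodule (𝓞 k) k).map
    ((LinearEquiv.funUnique (Fin 1) (𝓞 k) k).symm : k →ₗ[𝓞 k] (Fin 1 → k))

/-- The hermitian lattice `(V_{0,𝔞}, L_{0,𝔞})` of (3.1) as a `LatticeDatum` in dimension `1`.
[cite: KudlaRapoport2013, §3.2 (3.1) (arXiv v2 p. 16)] -/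
def idealLatticeDatum (𝔞 : (FractionalIdeal (𝓞 k)⁰ k)ˣ) : LatticeDatum k 1 :=
  ⟨idealGram 𝔞, idealLattice 𝔞⟩

/-- `g ∈ GL_n(k)` is an isomorphism of hermitian lattices `(J, L) → (J', L')`: an isometry with `g L = L'`
(`LatticePoint.Moves` without the plane). [cite: KudlaRapoport2013, §3.2 (arXiv v2 p. 16)] -/
def LatticeDatum.Moves {n : ℕ} (g : GL (Fin n) k) (X Y : LatticeDatum k n) : Prop :=
  formCongr (conj ℚ k : k →+* k) g Y.J = X.J ∧ Y.L = latticeImage g X.L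

/-- **[KR2013, (3.1)] CLOSED** (§3.2, arXiv v2 p. 16): «Consider the special case `n = 1` and `r = 0`. A fractional
ideal `𝔞` defines a self-dual hermitian lattice `L_{0,𝔞}` in the space `V_{0,𝔞} = k` with hermitian form
`(x, y) = N(𝔞)⁻¹ x y^σ`. This gives an isomorphism `C(k) ≅ 𝓛_{(1,0)}(k)`, `[𝔞] ↦ [L_{0,𝔞}]`, (3.1) where `C(k)` is the
ideal class group of `k` and `[L_{0,𝔞}]` denotes the isomorphism class of `L_{0,𝔞}`.»  TYPED for every complex
embedding `τ` of `k` (signature `(1, 0)` at `τ`), with `C(k)` = Mathlib `ClassGroup (𝓞 k)`, in three clauses: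
(i) `(V_{0,𝔞}, L_{0,𝔞})` is a self-dual hermitian lattice of signature `(1, 0)`; (ii) well-defined and injective on
classes: `L_{0,𝔞} ≅ L_{0,𝔟}` iff `[𝔞] = [𝔟]`; (iii) surjective: every self-dual hermitian lattice of signature `(1,0)` is
isomorphic to some `L_{0,𝔞}`. [cite: KudlaRapoport2013, §3.2 (3.1) (arXiv v2 p. 16)] -/
def KR2013_3_eq_3_1 : Prop :=
  ∀ (k : Type) [Field k] [NumberField k] [IsTotallyComplex k] [Algebra.IsQuadraticExtension ℚ k] (τ : k →+* ℂ),
    (∀ 𝔞 : (FractionalIdeal (𝓞 k)⁰ k)ˣ,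
        IsSelfDualHermLattice (conj ℚ k : k →+* k) τ 0 (idealLatticeDatum 𝔞)) ∧
    (∀ 𝔞 𝔟 : (FractionalIdeal (𝓞 k)⁰ k)ˣ,
        (∃ g : GL (Fin 1) k, LatticeDatum.Moves g (idealLatticeDatum 𝔞) (idealLatticeDatum 𝔟)) ↔
          ClassGroup.mk k 𝔞 = ClassGroup.mk k 𝔟) ∧
    (∀ X : LatticeDatum k 1, IsSelfDualHermLattice (conj ℚ k : k →+* k) τ 0 X →
        ∃ (𝔞 : (FractionalIdeal (𝓞 k)⁰ k)ˣ) (g : GL (Fin 1) k), LatticeDatum.Moves g X (idealLatticeDatum 𝔞))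

/-- **[KR2013, (3.2)] AS PRINTED** (§3.2, arXiv v2 p. 16), for the datum `D` and the consumer's groupoid structure on
`D.M0C = M₀(ℂ)`: «Since `D(L_{0,𝔞})` consists of a single point and `Γ_{L_{0,𝔞}} = O_k^×`, we obtain
`M₀(ℂ) ≅ ∐_{[𝔞] ∈ C(k)} [O_k^×∖D(L_{0,𝔞})] ≃ [O_k^×∖C(k)]`, (3.2) where `O_k^×` acts trivially on `D(L_{0,𝔞})` and `C(k)`.»
TYPED (READING R2): the groupoid `M₀(ℂ)` is equivalent to the transport groupoid of the TRIVIAL action of `O_k^× = (𝓞 k)ˣ`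
on `C(k) = ClassGroup (𝓞 k)` (objects the ideal classes, every object with automorphism group `O_k^×`).  A consumer takes
`(h : KR2013_3_eq_3_2 D)` for its own `D`. NO PROOF. [cite: KudlaRapoport2013, §3.2 (3.2) (arXiv v2 p. 16)] -/
def KR2013_3_eq_3_2 (D : Sec3Data.{u} k) [Groupoid.{v} D.M0C] : Prop :=
  IsGroupoidEquivOfAction D.M0C (G := (𝓞 k)ˣ) (X := ClassGroup (𝓞 k)) (fun _ x y => x = y)

/-! ### The adelic variant (arXiv v2 pp. 16–17): `L ⊗ Ẑ`, `K₁^{V♯}`, Corollary 3.2, Remarks 3.3–3.4 -/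

variable {n : ℕ}

/-- The finite adele ring `𝔸_{k,f}` of `k` (Mathlib). [cite: KudlaRapoport2013, §3.2 (arXiv v2 p. 16)] -/
abbrev FinAdele (k : Type) [Field k] [NumberField k] : Type :=
  IsDedekindDomain.FiniteAdeleRing (𝓞 k) k

/-- The diagonal embedding `kⁿ → 𝔸ⁿ_{k,f}`. [cite: KudlaRapoport2013, §3.2 (arXiv v2 p. 16)] -/
def toAdelicVec (v : Fin n → k) : Fin n → FinAdele k :=
  fun i => algebraMap k (FinAdele k) (v i)

/-- **`L ⊗_ℤ Ẑ ⊆ V(𝔸_f) = 𝔸ⁿ_{k,f}`** for an `O_k`-lattice `L ⊆ kⁿ` (READING R3): the closure of `L` in `𝔸ⁿ_{k,f}` («the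
stabilizer in `G₁^V(𝔸_f)` of a self-dual lattice», p. 16; «`(g (L̃ ⊗ Ẑ) g₀⁻¹)`», p. 18).
[cite: KudlaRapoport2013, §3.2 (arXiv v2 p. 16)] -/
def adelicLattice (L : Submodule (𝓞 k) (Fin n → k)) : Set (Fin n → FinAdele k) :=
  closure (toAdelicVec '' (L : Set (Fin n → k)))

/-- The image `g Λ` of a set of adelic vectors under `g ∈ GL_n(𝔸_{k,f})`. [cite: KudlaRapoport2013, §3.2 (arXiv v2 p. 16)] -/
def glImage {R : Type*} [CommRing R] (g : GL (Fin n) R) (Λ : Set (Fin n → R)) : Set (Fin n → R) :=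
  (fun v => (g : Matrix (Fin n) (Fin n) R) *ᵥ v) '' Λ

/-- `GL_n(k) → GL_n(𝔸_{k,f})`, the diagonal embedding on invertible matrices («`G₁^V(ℚ)∖G₁^V(𝔸_f)`», p. 16).
[cite: KudlaRapoport2013, §3.2 (arXiv v2 p. 16)] -/
def glToAdelic (g : GL (Fin n) k) : GL (Fin n) (FinAdele k) :=
  Matrix.GeneralLinearGroup.map (algebraMap k (FinAdele k)) g

/-- **`G₁^V(𝔸_f)`** for `V = (kⁿ, J)`: the tree's ★ `UnitaryGroup.finAdelic ℚ k (conj ℚ k) n J` («`G₁^V = U(V)`»; finite-adelic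
points). [cite: KudlaRapoport2013, §3.2 (arXiv v2 p. 16)] -/
abbrev G1Af (n : ℕ) (J : Matrix (Fin n) (Fin n) k) : Subgroup (GL (Fin n) (FinAdele k)) :=
  Literature.NumberTheory.Automorphic.UnitaryGroup.finAdelic ℚ k (conj ℚ k) n J

/-- **`K₁^V`, «the stabilizer in `G₁^V(𝔸_f)` of a self-dual lattice»** `L` (p. 16), i.e. of `L ⊗ Ẑ` (READING R3).
[cite: KudlaRapoport2013, §3.2 (arXiv v2 p. 16)] -/
def K1 (J : Matrix (Fin n) (Fin n) k) (L : Submodule (𝓞 k) (Fin n → k)) : Set (GL (Fin n) (FinAdele k)) :=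
  {κ | κ ∈ G1Af n J ∧ glImage κ (adelicLattice L) = adelicLattice L}

/-- **[KR2013 §3.2, the sentence before Corollary 3.2] CLOSED** (arXiv v2 p. 16): «Consider the map
`𝓛_{(n−r,r)}(k) → 𝓡_{(n−r,r)}(k)♯` given by `L ↦ (L ⊗_ℤ ℚ, [[L]])`. By construction, the fiber in `𝓛_{(n−r,r)}(k)` over
`(V, [[L]]) ∈ 𝓡_{(n−r,r)}(k)♯` is in bijection with `G₁^V(ℚ)∖G₁^V(𝔸_f)/K₁^V`, where `K₁^V` is the stabilizer in `G₁^V(𝔸_f)` of a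
self-dual lattice in `[[L]]`.»  TYPED (READING R3, `g K₁ ↦ g(L ⊗ Ẑ)`): for every self-dual hermitian lattice `(J, L)`
(any signature) and every `g ∈ G₁^V(𝔸_f)`, the adelic lattice `g(L ⊗ Ẑ)` comes from a unique lattice of the fibre,
namely `L' = g(L ⊗ Ẑ) ∩ kⁿ`: `L'` is a full `O_k`-lattice, self-dual for `J`, with `L' ⊗ Ẑ = g(L ⊗ Ẑ)` — so that
`L' ↦ L' ⊗ Ẑ` and `g ↦ g(L ⊗ Ẑ) ∩ kⁿ` are inverse bijections between the fibre (lattices in `V` in the genus of `L`, up to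
`G₁^V(ℚ)`) and `G₁^V(ℚ)∖G₁^V(𝔸_f)/K₁^V`. [cite: KudlaRapoport2013, §3.2 (arXiv v2 p. 16)] -/
def KR2013_3_2_fibre : Prop :=
  ∀ (k : Type) [Field k] [NumberField k] [IsTotallyComplex k] [Algebra.IsQuadraticExtension ℚ k] (n : ℕ)
    (J : Matrix (Fin n) (Fin n) k) (L : Submodule (𝓞 k) (Fin n → k)),
    IsHermitianFor (conj ℚ k : k →+* k) J → IsFullLattice L → IsSelfDualFor (conj ℚ k : k →+* k) J L →
    ∀ g : GL (Fin n) (FinAdele k), g ∈ G1Af n J →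
      ∃ L' : Submodule (𝓞 k) (Fin n → k),
        (L' : Set (Fin n → k)) = {v | toAdelicVec v ∈ glImage g (adelicLattice L)} ∧
        IsFullLattice L' ∧ IsSelfDualFor (conj ℚ k : k →+* k) J L' ∧
        adelicLattice L' = glImage g (adelicLattice L)

/-- The objects of the transport groupoid `∐_{V♯} [G₁^V(ℚ)∖(D(V) × G₁^V(𝔸_f)/K₁^{V♯})]` of Corollary 3.2 (READINGS
R0, R2, R3): a relevant hermitian space `V = (kⁿ, J)` of signature `(n−r, r)`, an adelic lattice `Λ = g(L ⊗ Ẑ)` in the genus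
(`G₁^V(𝔸_f)`-orbit) of a self-dual lattice `L` — the pair `(V, [[L]]) = V♯ ∈ 𝓡_{(n−r,r)}(k)♯` together with the coset `g K₁^{V♯}`
— and a negative `r`-plane `z ∈ D(V)`. [cite: KudlaRapoport2013, §3.2 Cor. 3.2 (arXiv v2 p. 17)] -/
structure AdelicPoint (D : Sec3Data.{u} k) : Type where
  /-- the Gram matrix of the relevant hermitian space `V` -/
  J : Matrix (Fin D.n) (Fin D.n) k
  /-- the adelic lattice `g(L ⊗ Ẑ)`, i.e. the coset `g K₁^{V♯}` (READING R3) -/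
  Λ : Set (Fin D.n → FinAdele k)
  /-- the negative `r`-plane `z ∈ D(V)` -/
  z : Submodule ℂ (Fin D.n → ℂ)
  isHermitian : IsHermitianFor (conj ℚ k : k →+* k) J
  hasSignature : HasSignatureAt D.τ J D.r
  mem_genus : ∃ L : Submodule (𝓞 k) (Fin D.n → k), IsFullLattice L ∧ IsSelfDualFor (conj ℚ k : k →+* k) J L ∧
    ∃ g : GL (Fin D.n) (FinAdele k), g ∈ G1Af D.n J ∧ Λ = glImage g (adelicLattice L)
  mem_negPlanes : z ∈ negPlanes D.r (J.map D.τ)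

/-- `γ ∈ GL_n(k)` carries `(V, Λ, z)` to `(V', Λ', z')`: an isometry `V → V'` with `γ Λ = Λ'` (diagonally in `GL_n(𝔸_{k,f})`) and
`γ z = z'`; for `V = V'` these are the `γ ∈ G₁^V(ℚ)`. [cite: KudlaRapoport2013, §3.2 Cor. 3.2 (arXiv v2 p. 17)] -/
def AdelicPoint.Moves {D : Sec3Data.{u} k} (γ : GL (Fin D.n) k) (P Q : AdelicPoint D) : Prop :=
  formCongr (conj ℚ k : k →+* k) γ Q.J = P.J ∧ Q.Λ = glImage (glToAdelic γ) P.Λ ∧ Q.z = planeImage D.τ γ P.z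

/-- **[KR2013, Corollary 3.2] AS PRINTED** (§3.2, arXiv v2 p. 17), for the datum `D` and the consumer's groupoid structure
on `D.MC = M(n−r, r)(ℂ)`:

«There is an isomorphism of orbifolds `M(n−r, r)(ℂ) ≅ ∐_{V♯} [G₁^V(ℚ)∖(D(V) × G₁^V(𝔸_f)/K₁^{V♯})]`, where `V♯` runs over
`𝓡_{(n−r,r)}(k)♯`.»  (Followed by: «When `n` is odd, we will usually drop the `♯` here. On the other hand, when there are two
`G₁^V`-genera, the group `K₁^{V♯}` depends on `V♯`, not just on `V`.»)

TYPED (READINGS R0, R2, R3): the groupoid `M(n−r, r)(ℂ)` is equivalent to the transport groupoid of `AdelicPoint D` under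
`GL_n(k)`.  **Remark 3.4** (p. 17: «For a relevant hermitian space `Ṽ` in `𝓡_{(n−r,r)}(k)`, the set of complex points
`M^{Ṽ}(ℂ)` of the summand `M^{Ṽ}` of `M`, in the sense of the decomposition in Proposition 2.12, corresponds to the subset of
the product `M(n−r, r)(ℂ) × M₀(ℂ)` indexed by pairs `(V♯, V₀)` for which `Hom_k(V₀, V) ≅ Ṽ`») is RECORDED here and not typed:
it is a statement about the summands `M^{Ṽ}` of [KR2013, Prop. 2.12], a §2 carrier (squad file `Sec2GlobalModuliProblem`).
A consumer takes `(h : KR2013_3_2 D)` for its own `D`. NO PROOF. [cite: KudlaRapoport2013, §3.2 Cor. 3.2 (arXiv v2 p. 17)] -/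
def KR2013_3_2 (D : Sec3Data.{u} k) [Groupoid.{v} D.MC] : Prop :=
  IsGroupoidEquivOfAction D.MC (G := GL (Fin D.n) k) (AdelicPoint.Moves (D := D))

/-- **[KR2013, Remark 3.3] CLOSED** (§3.2, arXiv v2 p. 17): «In the special case `n = 1` and `r = 0`, the decomposition
`M₀(ℂ) ≅ ∐_{V₀} [G₁^{V₀}(ℚ)∖(D(V₀) × G₁^{V₀}(𝔸_f)/K₁^{V₀})]` in Corollary 3.2 corresponds to the decomposition of `C(k)` according
to genera. More precisely, the isomorphism class of the hermitian space `V_{0,𝔞} = L_{0,𝔞} ⊗ ℚ` is determined by the values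
`χ_p(det V_{0,𝔞}) = χ_p(N(𝔞)) = (N(𝔞), Δ)_p` as `p` runs over the primes dividing `Δ`. But these are just the values of the genus
characters `ξ_p([𝔞]) = (N(𝔞), Δ)_p`. Thus the fibers of the map `C(k) ≃ 𝓛_{(1,0)}(k) → 𝓡_{(1,0)}(k)` are the genera, i.e., the
cosets of the subgroup `C(k)²`.»  TYPED (the conclusion): for invertible fractional ideals `𝔞, 𝔟` of `k`, the hermitian spaces
`V_{0,𝔞}`, `V_{0,𝔟}` are isometric iff `[𝔞] ∈ [𝔟] · C(k)²`.  The final sentence «the inclusion of `k¹∖k¹_{𝔸_f}/Ô¹_k` into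
`k^×∖k^×_{𝔸_f}/Ô^×_k = C(k)` identifies `G₁^{V₀}(ℚ)∖G₁^{V₀}(𝔸_f)/K₁^{V₀} = k¹∖k¹_{𝔸_f}/Ô¹_k` with `C(k)²`» is RECORDED, not typed
(no norm-one idèle class group in the tree). [cite: KudlaRapoport2013, §3.2 Rem. 3.3 (arXiv v2 p. 17)] -/
def KR2013_3_3 : Prop :=
  ∀ (k : Type) [Field k] [NumberField k] [IsTotallyComplex k] [Algebra.IsQuadraticExtension ℚ k]
    (𝔞 𝔟 : (FractionalIdeal (𝓞 k)⁰ k)ˣ),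
    (∃ g : GL (Fin 1) k, formCongr (conj ℚ k : k →+* k) g (idealGram 𝔟) = idealGram 𝔞) ↔
      ∃ c : ClassGroup (𝓞 k), ClassGroup.mk k 𝔞 = ClassGroup.mk k 𝔟 * c ^ 2

end Sec32

/-! ## §3.3 (arXiv v2 pp. 17–19): complex points of the special cycles -/

section Sec33

variable {k : Type} [Field k] [NumberField k] [IsTotallyComplex k] [Algebra.IsQuadraticExtension ℚ k]
variable {n : ℕ}

/-- **`L̃ := Hom_{O_k}(L₀, L)`** (§3.3 p. 17) inside `Ṽ = Hom_k(V₀, V) = Matrix (Fin n) (Fin 1) k` (READING R0): the `k`-linear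
maps `x̃ : V₀ = k → V = kⁿ` with `x̃(L₀) ⊆ L`. [cite: KudlaRapoport2013, §3.3 (arXiv v2 p. 17)] -/
def homLattice (L₀ : Submodule (𝓞 k) (Fin 1 → k)) (L : Submodule (𝓞 k) (Fin n → k)) : Set (Matrix (Fin n) (Fin 1) k) :=
  {x | ∀ c ∈ L₀, x *ᵥ c ∈ L}

/-- The vector `x̃(1) ∈ V` of `x̃ ∈ Ṽ = Hom_k(V₀, V)` (its single column). [cite: KudlaRapoport2013, §3.3 (arXiv v2 p. 17)] -/
def colVec {R : Type*} (x : Matrix (Fin n) (Fin 1) R) : Fin n → R :=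
  fun i => x i 0

/-- **`h̃`, «the hermitian form on `L̃` coming from the hermitian forms `h_λ` and `h_{λ₀}`»** (§3.3 p. 17; §2.2 `h'(x, y) =
λ₀⁻¹ ∘ y^∨ ∘ λ ∘ x`, and the computation `h_λ(x(1), y(1)) = h'(x, y) h_{λ₀}(1, 1)` in the proof of Lemma 2.10, p. 10): for Gram
matrices `J` on `V` and `J₀` on `V₀ = k`, `h̃(x̃, ỹ) = (x̃(1), ỹ(1))_V · (1, 1)_{V₀}⁻¹` — the unique form with
`(x̃(u), ỹ(v))_V = h̃(x̃, ỹ) (u, v)_{V₀}`. [cite: KudlaRapoport2013, §3.3 (arXiv v2 p. 17)] -/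
def hTilde (σ : k →+* k) (J : Matrix (Fin n) (Fin n) k) (J₀ : Matrix (Fin 1) (Fin 1) k)
    (x y : Matrix (Fin n) (Fin 1) k) : k :=
  krForm σ J (colVec x) (colVec y) * (J₀ 0 0)⁻¹

/-- The matrix `h̃(x̃, x̃) = (h̃(x̃_i, x̃_j))_{i,j}` of an `m`-tuple `x̃ = [x̃₁, …, x̃_m] ∈ Ṽ^m` («fundamental matrix», §1; incidence
relation (1) `h̃(x̃, x̃) = T`, p. 17). [cite: KudlaRapoport2013, §3.3 (arXiv v2 p. 17)] -/
def gramTilde {m : ℕ} (σ : k →+* k) (J : Matrix (Fin n) (Fin n) k) (J₀ : Matrix (Fin 1) (Fin 1) k)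
    (x : Fin m → Matrix (Fin n) (Fin 1) k) : Matrix (Fin m) (Fin m) k :=
  Matrix.of fun i j => hTilde σ J J₀ (x i) (x j)

/-- **`D(L)_x̃ = {z ∈ D(L) | z ⊥ x̃_i(L₀) for all i}`** (incidence relation (2), §3.3 p. 17; also `D(V)_x̃`, p. 18), for the complex
Gram matrix `Jc = J^τ`: the negative `r`-planes orthogonal to the vectors `x̃_i(1) ∈ V ⊆ V ⊗_{k,τ} ℂ` (READING R1; «condition (2)
corresponds to the fact that the `k`-linear maps `x_i : Lie E → Lie A` are holomorphic»). [cite: KudlaRapoport2013, §3.3 (arXiv v2 p. 17)] -/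
def negPlanesPerp {m : ℕ} (τ : k →+* ℂ) (r : ℕ) (Jc : Matrix (Fin n) (Fin n) ℂ) (x : Fin m → Matrix (Fin n) (Fin 1) k) :
    Set (Submodule ℂ (Fin n → ℂ)) :=
  {z | z ∈ negPlanes r Jc ∧ ∀ i, ∀ w ∈ z, krFormC Jc (τ ∘ colVec (x i)) w = 0}

/-- **`Inc_∞(T; L, L₀) ⊂ D(L) × L̃^m`, «the set of pairs satisfying conditions (1) and (2)»** (§3.3 p. 17):
(1) `h̃(x̃, x̃) = T`, (2) `z ∈ D(L)_x̃`, for hermitian lattices `(J, L)` (signature `(n−r, r)`) and `(J₀, L₀)` (dimension 1).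
[cite: KudlaRapoport2013, §3.3 (arXiv v2 p. 17)] -/
def incInfty {m : ℕ} (σ : k →+* k) (τ : k →+* ℂ) (r : ℕ) (T : Matrix (Fin m) (Fin m) k) (X : LatticeDatum k n)
    (X₀ : LatticeDatum k 1) : Set (Submodule ℂ (Fin n → ℂ) × (Fin m → Matrix (Fin n) (Fin 1) k)) :=
  {p | (∀ i, p.2 i ∈ homLattice X₀.L X.L) ∧ gramTilde σ X.J X₀.J p.2 = T ∧ p.1 ∈ negPlanesPerp τ r (X.J.map τ) p.2}

/-- The objects of the transport groupoid `∐_{[L] ∈ 𝓛_{(n−r,r)}} ∐_{[L₀] ∈ 𝓛_{(1,0)}} [(O_k^× × Γ_L)∖Inc_∞(T; L, L₀)]` of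
Proposition 3.5 (READING R2): self-dual hermitian lattices `L = (J, L)` of signature `(n−r, r)` and `L₀ = (J₀, L₀)` of signature
`(1, 0)`, and a point `(z, x̃) ∈ Inc_∞(T; L, L₀)`. [cite: KudlaRapoport2013, §3.3 Prop. 3.5 (arXiv v2 p. 18)] -/
structure CyclePoint (D : Sec3Data.{u} k) (m : ℕ) (T : Matrix (Fin m) (Fin m) k) : Type where
  /-- the hermitian lattice `L` (with `V = L ⊗ ℚ = (kⁿ, J)`) -/
  X : LatticeDatum k D.n
  /-- the hermitian lattice `L₀` (with `V₀ = (k, J₀)`) -/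
  X₀ : LatticeDatum k 1
  /-- the negative `r`-plane `z ∈ D(L)` -/
  z : Submodule ℂ (Fin D.n → ℂ)
  /-- the `m`-tuple `x̃ ∈ L̃^m` -/
  x : Fin m → Matrix (Fin D.n) (Fin 1) k
  isLattice : IsSelfDualHermLattice (conj ℚ k : k →+* k) D.τ D.r X
  isLattice₀ : IsSelfDualHermLattice (conj ℚ k : k →+* k) D.τ 0 X₀
  mem_incInfty : (z, x) ∈ incInfty (conj ℚ k : k →+* k) D.τ D.r T X X₀

/-- `(g, g₀) ∈ GL_n(k) × GL₁(k)` carries `(L, L₀, z, x̃)` to `(L', L₀', z', x̃')`: isomorphisms of hermitian lattices `g : L → L'`,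
`g₀ : L₀ → L₀'` with `g z = z'` and `x̃' = g ∘ x̃ ∘ g₀⁻¹`; for fixed `(L, L₀)` these are the elements of `Γ_L × O_k^×`, `O_k^×`
acting «by scalar multiplication on the `x̃`-component» (p. 18). [cite: KudlaRapoport2013, §3.3 Prop. 3.5 (arXiv v2 p. 18)] -/
def CyclePoint.Moves {D : Sec3Data.{u} k} {m : ℕ} {T : Matrix (Fin m) (Fin m) k} (g : GL (Fin D.n) k × GL (Fin 1) k)
    (P Q : CyclePoint D m T) : Prop :=
  LatticeDatum.Moves g.1 P.X Q.X ∧ LatticeDatum.Moves g.2 P.X₀ Q.X₀ ∧ Q.z = planeImage D.τ g.1 P.z ∧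
    ∀ i, Q.x i = (g.1 : Matrix (Fin D.n) (Fin D.n) k) * P.x i * ((g.2⁻¹ : GL (Fin 1) k) : Matrix (Fin 1) (Fin 1) k)

/-- **[KR2013, Proposition 3.5] AS PRINTED** (§3.3, arXiv v2 p. 18), for the datum `D`, `T ∈ Herm_m(O_k)` (given as a matrix
over `k`) and the consumer's groupoid structure on `D.ZC m T = Z(T)(ℂ)`:

«Let `T ∈ Herm_m(O_k)`. Then there is an isomorphism of orbifolds
`Z(T)(ℂ) ≃ ∐_{[L] ∈ 𝓛_{(n−r,r)}} ∐_{[L₀] ∈ 𝓛_{(1,0)}} [(O_k^× × Γ_L)∖Inc_∞(T; L, L₀)]`.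
Here `O_k^×` acts by scalar multiplication on the `x̃`-component of an element of `Inc_∞(T; L, L₀)`.»

TYPED (READINGS R0–R2): the groupoid `Z(T)(ℂ)` is equivalent to the transport groupoid of `CyclePoint D m T` under
`GL_n(k) × GL₁(k)`.  The explicit form **(3.5)** (p. 18: «`Z(T)(ℂ) ≃ ∐_{[𝔞] ∈ C(k)} ∐_{[L] ∈ 𝓛_{(n−r,r)}} [(O_k^× × Γ_L)∖
∐_{x ∈ L_𝔞^m, (x,x)_𝔞 = T} D(L)_x]`») is the same groupoid with `[L₀] = [L_{0,𝔞⁻¹}]` re-indexed by `[𝔞] ∈ C(k)` through (3.1) and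
`L̃ = L_𝔞` through (3.4) (`KR2013_3_eq_3_1`, `KR2013_3_eq_3_4`); it is not typed a second time.  The printed construction
(`H = H₁(A(ℂ), ℤ)`, `H₀ = H₁(E(ℂ), ℤ)`, `x̃ = j ∘ x ∘ j₀⁻¹`) is not typed.  A consumer takes `(h : KR2013_3_5 D m T)` for its own data.
NO PROOF. [cite: KudlaRapoport2013, §3.3 Prop. 3.5 (arXiv v2 p. 18)] -/
def KR2013_3_5 (D : Sec3Data.{u} k) (m : ℕ) (T : Matrix (Fin m) (Fin m) k) [Groupoid.{v} (D.ZC m T)] : Prop :=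
  IsGroupoidEquivOfAction (D.ZC m T) (G := GL (Fin D.n) k × GL (Fin 1) k) (CyclePoint.Moves (D := D) (m := m) (T := T))

/-- **(3.3): the hermitian form `(x, x)_𝔞 = (x, x)/N(𝔞)` of `L_𝔞`** (§3.3 p. 18), as the Gram matrix `N(𝔞)⁻¹ J`.
[cite: KudlaRapoport2013, §3.3 (3.3) (arXiv v2 p. 18)] -/
def twistGram (𝔞 : (FractionalIdeal (𝓞 k)⁰ k)ˣ) (J : Matrix (Fin n) (Fin n) k) : Matrix (Fin n) (Fin n) k :=
  (algebraMap ℚ k (FractionalIdeal.absNorm (𝔞 : FractionalIdeal (𝓞 k)⁰ k)))⁻¹ • J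

/-- **`L_𝔞 = 𝔞 ⊗_{O_k} L`** (§3.3 p. 18), realised inside `V = kⁿ` as the product submodule `𝔞 · L`.
[cite: KudlaRapoport2013, §3.3 (3.3) (arXiv v2 p. 18)] -/
def twistLattice (𝔞 : (FractionalIdeal (𝓞 k)⁰ k)ˣ) (L : Submodule (𝓞 k) (Fin n → k)) : Submodule (𝓞 k) (Fin n → k) :=
  ((𝔞 : FractionalIdeal (𝓞 k)⁰ k) : Submodule (𝓞 k) k) • L

/-- **[KR2013, (3.4)] CLOSED** (§3.3, arXiv v2 p. 18): «Then, `L_𝔞` is again a self-dual lattice, `L_𝔞 ≃ Hom_{O_k}(L_{0,𝔞⁻¹}, L)`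
(3.4) as hermitian lattices».  TYPED as the literal identification inside `V` (READING R0, `x̃ ↦ x̃(1)`): for every `O_k`-submodule
`L ⊆ kⁿ`, every Gram matrix `J`, and every invertible fractional ideal `𝔞`, (i) `x̃ ∈ Hom_{O_k}(L_{0,𝔞⁻¹}, L)` iff `x̃(1) ∈ 𝔞 · L = L_𝔞`,
and (ii) `h̃(x̃, ỹ) = (x̃(1), ỹ(1))_𝔞` for the forms `h̃` of `Hom(V_{0,𝔞⁻¹}, V)` and `( , )_𝔞 = ( , )/N(𝔞)` of (3.3); and (iii) for `(J, L)` a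
self-dual hermitian lattice, `(N(𝔞)⁻¹ J, L_𝔞)` is self-dual («`L_𝔞` is again a self-dual lattice»). [cite: KudlaRapoport2013, §3.3 (3.4) (arXiv v2 p. 18)] -/
def KR2013_3_eq_3_4 : Prop :=
  ∀ (k : Type) [Field k] [NumberField k] [IsTotallyComplex k] [Algebra.IsQuadraticExtension ℚ k] (n : ℕ)
    (J : Matrix (Fin n) (Fin n) k) (L : Submodule (𝓞 k) (Fin n → k)) (𝔞 : (FractionalIdeal (𝓞 k)⁰ k)ˣ),
    (∀ x : Matrix (Fin n) (Fin 1) k, x ∈ homLattice (idealLattice 𝔞⁻¹) L ↔ colVec x ∈ twistLattice 𝔞 L) ∧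
    (∀ x y : Matrix (Fin n) (Fin 1) k,
      hTilde (conj ℚ k : k →+* k) J (idealGram 𝔞⁻¹) x y = krForm (conj ℚ k : k →+* k) (twistGram 𝔞 J) (colVec x) (colVec y)) ∧
    (IsHermitianFor (conj ℚ k : k →+* k) J → IsFullLattice L → IsSelfDualFor (conj ℚ k : k →+* k) J L →
      IsSelfDualFor (conj ℚ k : k →+* k) (twistGram 𝔞 J) (twistLattice 𝔞 L))

/-- **[KR2013 §3.3, the sentence before Corollary 3.6] CLOSED** (arXiv v2 p. 18): «If `x̃ ∈ (L̃ ⊗ ℝ)^m` with `h̃(x̃, x̃) = T > 0`,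
then `m ≤ n−r` and `D(L)_x̃` has codimension `mr` in `D(L)`.»  TYPED (READING R1, `L̃ ⊗ ℝ = Ṽ ⊗_{k,τ} ℂ = ℂⁿ`): for a complex
hermitian Gram matrix `Jc` of signature `(n−r, r)` (congruent to `signDiag n r`), a positive real `a = (1,1)_{V₀}` and vectors
`x̃₁, …, x̃_m ∈ ℂⁿ` whose matrix `h̃(x̃, x̃) = (⟨x̃_i, x̃_j⟩/a)` is positive definite, `m ≤ n − r`.  The codimension clause («`D(L)_x̃`
has codimension `mr` in `D(L)`», a statement about complex manifolds: `D(L)_x̃ ≅ D(x̃^⊥)` with `x̃^⊥` of signature `(n−r−m, r)`)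
is RECORDED, not typed. [cite: KudlaRapoport2013, §3.3 (arXiv v2 p. 18)] -/
def KR2013_3_6_pre : Prop :=
  ∀ (n r m : ℕ) (Jc : Matrix (Fin n) (Fin n) ℂ),
    (∃ T : GL (Fin n) ℂ, (T : Matrix (Fin n) (Fin n) ℂ)ᴴ * Jc * (T : Matrix (Fin n) (Fin n) ℂ) = signDiag n r) →
    ∀ (a : ℝ), 0 < a → ∀ x : Fin m → (Fin n → ℂ),
      (Matrix.of fun i j => krFormC Jc (x i) (x j) * ((a : ℂ))⁻¹).PosDef → m ≤ n - r

/-- **[KR2013, Corollary 3.6, second sentence] CLOSED at the level of `Inc_∞`** (arXiv v2 p. 18: «If `m > n−r`, then `Z(T)(ℂ)`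
is empty»), via Prop. 3.5: for `T ∈ Herm_m(k)` positive definite at `τ` and `m > n − r`, `Inc_∞(T; L, L₀) = ∅` for all self-dual
hermitian lattices `L` of signature `(n−r, r)` and `L₀` of signature `(1, 0)`. [cite: KudlaRapoport2013, §3.3 Cor. 3.6 (arXiv v2 p. 18)] -/
def KR2013_3_6_empty : Prop :=
  ∀ (k : Type) [Field k] [NumberField k] [IsTotallyComplex k] [Algebra.IsQuadraticExtension ℚ k] (τ : k →+* ℂ)
    (n r m : ℕ) (T : Matrix (Fin m) (Fin m) k), (T.map τ).PosDef → n - r < m →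
    ∀ (X : LatticeDatum k n) (X₀ : LatticeDatum k 1),
      IsSelfDualHermLattice (conj ℚ k : k →+* k) τ r X → IsSelfDualHermLattice (conj ℚ k : k →+* k) τ 0 X₀ →
      incInfty (conj ℚ k : k →+* k) τ r T X X₀ = ∅

/-- **[KR2013, Corollary 3.6] AS PRINTED** (§3.3, arXiv v2 p. 18), for the datum `D`, `T`, the consumer's groupoid structure on
`Z(T)(ℂ)` and its ⟨CARRIER⟩ codimension `codim` («codimension of `Z(T)(ℂ)`» in `M(n−r, r)(ℂ) × M₀(ℂ)`, a number the consumer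
supplies for its own model — no dimension theory of the carrier is available here):

«For `T ∈ Herm_m(O_k)_{>0}`, and `m ≤ n−r`, the cycle `Z(T)(ℂ)` has codimension `mr`. If `m > n−r`, then `Z(T)(ℂ)` is empty.»

TYPED: `T > 0` = `(T.map τ)` positive definite (READING R1); (i) `m ≤ n − r → codim = m r`; (ii) `m > n − r → Z(T)(ℂ)` has no objects.
The REAL content of (ii) is the CLOSED companion `KR2013_3_6_empty` (with Prop. 3.5); of (i), `KR2013_3_6_pre`.  A consumer
takes `(h : KR2013_3_6 D m T codim)` for its own data. NO PROOF. [cite: KudlaRapoport2013, §3.3 Cor. 3.6 (arXiv v2 p. 18)] -/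
def KR2013_3_6 (D : Sec3Data.{u} k) (m : ℕ) (T : Matrix (Fin m) (Fin m) k) [Groupoid.{v} (D.ZC m T)] (codim : ℕ) : Prop :=
  (T.map D.τ).PosDef →
    (m ≤ D.n - D.r → codim = m * D.r) ∧ (D.n - D.r < m → IsEmpty (D.ZC m T))

/-- **[KR2013, Remark 3.7] — the Kudla–Millson cycles `Z(T; L_𝔞, Γ_L)`** (§3.3, arXiv v2 p. 18): «The cycles occurring here
are essentially those studied in the joint work of the first author with John Millson. More precisely, let `pr : D(L) → Γ_L∖D(L)`
be the projection. Then the cycles `Z(T; L_𝔞, Γ_L) = ∐_{x ∈ L_𝔞^m, (x,x)_𝔞 = T, mod Γ_L} pr(D(L)_x)` of codimension `mr` in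
`Γ_L∖D(L)` are those introduced in [33], [34], [35], and, in the case of signature `(2,1)`, in [28].»  TYPED as the
`Γ_L`-invariant subset `⋃_{x ∈ L_𝔞^m, (x,x)_𝔞 = T} D(L)_x ⊆ D(L)` whose image under `pr` is `Z(T; L_𝔞, Γ_L)` (the quotient by `Γ_L` and
«codimension `mr`» are not typed). [cite: KudlaRapoport2013, §3.3 Rem. 3.7 (arXiv v2 p. 18)] [cite: KudlaMillson1990, §2] -/
def kmCycle {m : ℕ} (τ : k →+* ℂ) (r : ℕ) (T : Matrix (Fin m) (Fin m) k) (X : LatticeDatum k n)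
    (𝔞 : (FractionalIdeal (𝓞 k)⁰ k)ˣ) : Set (Submodule ℂ (Fin n → ℂ)) :=
  {z | z ∈ negPlanes r (X.J.map τ) ∧ ∃ x : Fin m → (Fin n → k), (∀ i, x i ∈ twistLattice 𝔞 X.L) ∧
    (Matrix.of fun i j => krForm (conj ℚ k : k →+* k) (twistGram 𝔞 X.J) (x i) (x j)) = T ∧
    ∀ i, ∀ w ∈ z, krFormC (X.J.map τ) (τ ∘ x i) w = 0}

/-- The objects of the transport groupoid `∐_{V♯} ∐_{V₀} [(G₁^V(ℚ) × G₁^{V₀}(ℚ))∖Inc_∞(T; V♯, V₀)]` of Proposition 3.8 (READINGS R0, R2,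
R3): relevant hermitian spaces `V = (kⁿ, J)` of signature `(n−r, r)` and `V₀ = (k, J₀)` of signature `(1, 0)`, adelic lattices
`Λ = g(L ⊗ Ẑ)`, `Λ₀ = g₀(L₀ ⊗ Ẑ)` (the cosets `g K₁^{V♯}`, `g₀ K₁^{V₀}`), `z ∈ D(V)` and `x̃ ∈ Ṽ(ℚ)^m`, `Ṽ = Hom_k(V₀, V)`, subject to the
incidence relations (p. 18): (0) `x̃ ∈ (g(L̃ ⊗ Ẑ)g₀⁻¹)^m`, `L̃ = Hom_{O_k}(L₀, L)` — i.e. each `x̃_i` maps `Λ₀` into `Λ`; (1) `(x̃, x̃) = T`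
(the form `h̃` of `Ṽ`); (2) `z ∈ D(V)_x̃`. [cite: KudlaRapoport2013, §3.3 Prop. 3.8 (arXiv v2 pp. 18–19)] -/
structure AdelicCyclePoint (D : Sec3Data.{u} k) (m : ℕ) (T : Matrix (Fin m) (Fin m) k) : Type where
  /-- the Gram matrix of `V` -/
  J : Matrix (Fin D.n) (Fin D.n) k
  /-- the adelic lattice `g(L ⊗ Ẑ)` (the coset `g K₁^{V♯}`) -/
  Λ : Set (Fin D.n → FinAdele k)
  /-- the Gram matrix of `V₀` -/
  J₀ : Matrix (Fin 1) (Fin 1) k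
  /-- the adelic lattice `g₀(L₀ ⊗ Ẑ)` (the coset `g₀ K₁^{V₀}`) -/
  Λ₀ : Set (Fin 1 → FinAdele k)
  /-- the negative `r`-plane `z ∈ D(V)` -/
  z : Submodule ℂ (Fin D.n → ℂ)
  /-- the `m`-tuple `x̃ ∈ Ṽ(ℚ)^m` -/
  x : Fin m → Matrix (Fin D.n) (Fin 1) k
  isHermitian : IsHermitianFor (conj ℚ k : k →+* k) J
  hasSignature : HasSignatureAt D.τ J D.r
  mem_genus : ∃ L : Submodule (𝓞 k) (Fin D.n → k), IsFullLattice L ∧ IsSelfDualFor (conj ℚ k : k →+* k) J L ∧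
    ∃ g : GL (Fin D.n) (FinAdele k), g ∈ G1Af D.n J ∧ Λ = glImage g (adelicLattice L)
  isHermitian₀ : IsHermitianFor (conj ℚ k : k →+* k) J₀
  hasSignature₀ : HasSignatureAt D.τ J₀ 0
  mem_genus₀ : ∃ L₀ : Submodule (𝓞 k) (Fin 1 → k), IsFullLattice L₀ ∧ IsSelfDualFor (conj ℚ k : k →+* k) J₀ L₀ ∧
    ∃ g₀ : GL (Fin 1) (FinAdele k), g₀ ∈ G1Af 1 J₀ ∧ Λ₀ = glImage g₀ (adelicLattice L₀)
  mem_negPlanes : z ∈ negPlanes D.r (J.map D.τ)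
  /-- incidence (0): `x̃_i ∈ g(L̃ ⊗ Ẑ)g₀⁻¹`, i.e. `x̃_i(Λ₀) ⊆ Λ` -/
  inc₀ : ∀ i, ∀ c ∈ Λ₀, ((x i).map (algebraMap k (FinAdele k))) *ᵥ c ∈ Λ
  /-- incidence (1): `(x̃, x̃) = T` -/
  inc₁ : gramTilde (conj ℚ k : k →+* k) J J₀ x = T
  /-- incidence (2): `z ∈ D(V)_x̃` -/
  inc₂ : ∀ i, ∀ w ∈ z, krFormC (J.map D.τ) (D.τ ∘ colVec (x i)) w = 0

/-- `(γ, γ₀) ∈ GL_n(k) × GL₁(k)` carries one adelic cycle point to another: isometries `V → V'`, `V₀ → V₀'` transporting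
`Λ, Λ₀, z` and `x̃ ↦ γ ∘ x̃ ∘ γ₀⁻¹`; for fixed `(V, V₀)` these are the elements of `G₁^V(ℚ) × G₁^{V₀}(ℚ)`.
[cite: KudlaRapoport2013, §3.3 Prop. 3.8 (arXiv v2 p. 19)] -/
def AdelicCyclePoint.Moves {D : Sec3Data.{u} k} {m : ℕ} {T : Matrix (Fin m) (Fin m) k} (γ : GL (Fin D.n) k × GL (Fin 1) k)
    (P Q : AdelicCyclePoint D m T) : Prop :=
  formCongr (conj ℚ k : k →+* k) γ.1 Q.J = P.J ∧ Q.Λ = glImage (glToAdelic γ.1) P.Λ ∧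
    formCongr (conj ℚ k : k →+* k) γ.2 Q.J₀ = P.J₀ ∧ Q.Λ₀ = glImage (glToAdelic γ.2) P.Λ₀ ∧
    Q.z = planeImage D.τ γ.1 P.z ∧
    ∀ i, Q.x i = (γ.1 : Matrix (Fin D.n) (Fin D.n) k) * P.x i * ((γ.2⁻¹ : GL (Fin 1) k) : Matrix (Fin 1) (Fin 1) k)

/-- **[KR2013, Proposition 3.8] AS PRINTED** (§3.3, arXiv v2 p. 19), for the datum `D`, `T ∈ Herm_m(O_k)` and the consumer's
groupoid structure on `Z(T)(ℂ)`: «Let `T ∈ Herm_m(O_k)`. Then there is an isomorphism of orbifolds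
`Z(T)(ℂ) ≃ ∐_{V♯ ∈ 𝓡♯_{(n−r,r)}} ∐_{V₀ ∈ 𝓡_{(1,0)}} [(G₁^V(ℚ) × G₁^{V₀}(ℚ))∖Inc_∞(T; V♯, V₀)]`», where (p. 19)
«`Inc_∞(T; V♯, V₀) ⊂ D(V) × G₁^V(𝔸_f)/K₁^{V♯} × G₁^{V₀}(𝔸_f)/K₁^{V₀} × Ṽ(ℚ)^m` [is] the subset of collections satisfying conditions
(0), (1) and (2)».  TYPED (READINGS R0–R3): the groupoid `Z(T)(ℂ)` is equivalent to the transport groupoid of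
`AdelicCyclePoint D m T` under `GL_n(k) × GL₁(k)`.  A consumer takes `(h : KR2013_3_8 D m T)` for its own data. NO PROOF.
[cite: KudlaRapoport2013, §3.3 Prop. 3.8 (arXiv v2 p. 19)] -/
def KR2013_3_8 (D : Sec3Data.{u} k) (m : ℕ) (T : Matrix (Fin m) (Fin m) k) [Groupoid.{v} (D.ZC m T)] : Prop :=
  IsGroupoidEquivOfAction (D.ZC m T) (G := GL (Fin D.n) k × GL (Fin 1) k)
    (AdelicCyclePoint.Moves (D := D) (m := m) (T := T))

end Sec33

/-! ## ED. 2 — bridge to the squad's §2 file ★ `KudlaRapoport2013.Sec2Defs` (import order §2 → §3, ruling R-8a) -/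

section Sec2Bridge

open _root_.AlgebraicGeometry (Spec)
open Literature.NumberTheory.Automorphic.Liu2021.AppendixC (HermSpace)
open Literature.AlgebraicGeometry.ShimuraVarieties.KudlaRapoport2013.Sec2Defs (SelfDualLattice Sec2Core)

/-- **`krForm` is the tree's ★ `ShimuraVarieties.hermForm` with the two vector arguments swapped** (READING R0;
`hermForm σ H u v = (σ ∘ u) ⬝ᵥ (H *ᵥ v)` is conjugate-linear in the FIRST variable, KR's `( , )` in the SECOND):
definitional (`rfl`).  Recorded as a theorem on the QA box's request (T-ref6 N1) so that the bridge is machine-visible;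
the content is KR's convention «`h'(x, y) = λ₀⁻¹ ∘ y^∨ ∘ λ ∘ x`» (linear in `x`). [cite: KudlaRapoport2013, §2.2 (2.4) and §3.1 (arXiv v2 pp. 9, 15)] -/
theorem krForm_eq_hermForm {R : Type*} [CommRing R] {n : ℕ} (σ : R →+* R) (J : Matrix (Fin n) (Fin n) R)
    (u v : Fin n → R) : krForm σ J u v = hermForm σ J v u :=
  rfl

variable {k : Type} [Field k] [NumberField k] [IsTotallyComplex k] [Algebra.IsQuadraticExtension ℚ k]

/-- **BRIDGE to the basis-free dress of the §2 file** (moved from `Sec2Defs` ED. v2 (p848315) to keep the import order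
§2 → §3; requested by the p848160 review): the coordinates of a self-dual lattice `L ⊂ V` (★ `Sec2Defs.SelfDualLattice k V`,
`V` = ★ `HermSpace ℚ k`) in the basis ★ `HermSpace.basis` of `V` — the `O_k`-submodule of `k^n` spanned by
`{coordinates of x ∣ x ∈ L}` (equal to that set, `L` being an `O_k`-module), the `L` of a `LatticeDatum`.  In these
coordinates `(x, y) = krForm σ (V.gram) [x] [y]` (★ `HermSpace.gram i j = (e_j, e_i)`, `krForm σ J u v = σ(v)ᵀ J u`), so
«self-dual» there is `IsSelfDualFor (conj ℚ k) V.gram (SelfDualLattice.coords L)` here (a provable consistency, not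
asserted).  (Verbatim from `Sec2Defs` v2 up to the namespace; dot-notation `L.coords` is not available since the
declaration lives in this file's namespace.) [cite: KudlaRapoport2013, §2.4 and §3.2 (arXiv v2 pp. 10, 16)] -/
def SelfDualLattice.coords {V : HermSpace ℚ k} (L : SelfDualLattice k V) : Submodule (𝓞 k) (Fin V.n → k) :=
  Submodule.span (𝓞 k) (V.basis.equivFun '' (L.carrier : Set V.V))

/-- **BRIDGE**: the self-dual lattice `L ⊂ V` of the §2 file as a `LatticeDatum k V.n` of this file — Gram matrix
★ `V.gram`, module `SelfDualLattice.coords L` (so that `R_{(n−r,r)}(k)` there (★ `Sec2Defs.Sec2Core.IsRelevant`) and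
`𝓛_{(n−r,r)}(k)` here (`IsSelfDualHermLattice`) speak about the same objects).  Moved from `Sec2Defs` ED. v2 (p848315),
see `SelfDualLattice.coords`. [cite: KudlaRapoport2013, §2.4 and §3.2 (arXiv v2 pp. 10, 16)] -/
def SelfDualLattice.toLatticeDatum {V : HermSpace ℚ k} (L : SelfDualLattice k V) : LatticeDatum k V.n :=
  ⟨V.gram, SelfDualLattice.coords L⟩

/-- **`Spec ℂ → Spec O_k` induced by the fixed embedding `τ : k → ℂ`** (§3 p. 15 «we fix an embedding `τ` of `k` into
`ℂ`»; the complex points of the `O_k`-stacks of §2 are their objects over this `O_k`-scheme): `Spec` of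
`τ ∘ (O_k ⊂ k) : O_k → ℂ`. REAL. [cite: KudlaRapoport2013, §3 (arXiv v2 p. 15)] -/
def specOfEmbedding (τ : k →+* ℂ) : Spec (.of ℂ) ⟶ Spec (.of (𝓞 k)) :=
  Spec.map (CommRingCat.ofHom (τ.comp (algebraMap (𝓞 k) k)))

/-- **ED. 2 instantiation of the ⟨CARRIER⟩ fields of `Sec3Data` by the squad's §2 objects** (R-8a): for the §2 datum
`C` (★ `Sec2Defs.Sec2Core k`: `n`, `r` and the clause carriers of §2.1–2.2) and the embedding `τ`, the §3 datum with
`MC := C.Obj (specOfEmbedding τ)` = the objects `(A, ι, λ)` of `M(n−r,r)(Spec ℂ)` (★ `Sec2Core.Obj`, Def. 2.4),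
`M0C := C.M0Obj (specOfEmbedding τ)` = the objects `(E, ι₀, λ₀)` of `M₀(Spec ℂ)` (★ `Sec2Core.M0Obj`, Ex. 2.2), and
`ZC m T :=` the objects `(A, ι, λ, E, ι₀, λ₀; x)` of `Z(T')(Spec ℂ)` (★ `Sec2Core.ZObj`, Def. 2.8) for THE `T' ∈ Herm_m(O_k)`
mapping to `T` under `O_k ⊂ k` (at most one; none — the empty type — when `T` is not integral, where the print does not
define `Z(T)`).  Every row `KR2013_3_… D` of this file applies verbatim to `D := Sec3Data.ofSec2 C τ`; the groupoid
structures remain the consumer's (`Sec3Data.GroupoidMatchesIso…` below tie them to the printed isomorphisms).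
[cite: KudlaRapoport2013, §2.1 Definition 2.4, Example 2.2, §2.2 Definition 2.8, §3 (arXiv v2 pp. 8–9, 15)] -/
abbrev Sec3Data.ofSec2 (C : Sec2Core k) (τ : k →+* ℂ) : Sec3Data.{1} k :=
  { τ := τ
    n := C.n
    r := C.r
    one_le_n := C.one_le_n
    r_le_n := C.r_le_n
    MC := C.Obj (specOfEmbedding τ)
    M0C := C.M0Obj (specOfEmbedding τ)
    ZC := fun m T => Σ T' : {T' : Matrix (Fin m) (Fin m) (𝓞 k) // T'.map (algebraMap (𝓞 k) k) = T},
      C.ZObj (specOfEmbedding τ) T'.1 }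

/-- The consumer's groupoid structure on `M(n−r,r)(ℂ) = (Sec3Data.ofSec2 C τ).MC` HAS THE PRINTED ISOMORPHISMS (§2.1 p. 8:
«an `O_k`-linear isomorphism `φ : A → A'` such that `φ^*(λ') = λ`» = ★ `Sec2Core.NaiveObj.Iso`): `x ⟶ y` is inhabited iff
`x ≅ y` as printed.  A consumer states `KR2013_3_1 (Sec3Data.ofSec2 C τ)` together with this. [cite: KudlaRapoport2013, §2.1 (arXiv v2 p. 8)] -/
def Sec3Data.GroupoidMatchesIso (C : Sec2Core k) (τ : k →+* ℂ) [Groupoid.{v} (Sec3Data.ofSec2 C τ).MC] : Prop :=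
  ∀ x y : (Sec3Data.ofSec2 C τ).MC, Nonempty (x ⟶ y) ↔ Sec2Core.NaiveObj.Iso x.toNaiveObj y.toNaiveObj

/-- The consumer's groupoid structure on `M₀(ℂ) = (Sec3Data.ofSec2 C τ).M0C` has the printed isomorphisms
(★ `Sec2Core.M0Obj.Iso`, Ex. 2.2). [cite: KudlaRapoport2013, §2.1 Example 2.2 (arXiv v2 p. 8)] -/
def Sec3Data.GroupoidMatchesIso₀ (C : Sec2Core k) (τ : k →+* ℂ) [Groupoid.{v} (Sec3Data.ofSec2 C τ).M0C] : Prop :=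
  ∀ x y : (Sec3Data.ofSec2 C τ).M0C, Nonempty (x ⟶ y) ↔ Sec2Core.M0Obj.Iso x y

/-- The consumer's groupoid structure on `Z(T)(ℂ) = (Sec3Data.ofSec2 C τ).ZC m T` has the printed isomorphisms
(★ `Sec2Core.ZObj.Iso`, Def. 2.8; the integral matrix `T'` over `T` is unique, so the two components agree).
[cite: KudlaRapoport2013, §2.2 Definition 2.8 (arXiv v2 p. 9)] -/
def Sec3Data.GroupoidMatchesIsoZ (C : Sec2Core k) (τ : k →+* ℂ) (m : ℕ) (T : Matrix (Fin m) (Fin m) k)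
    [Groupoid.{v} ((Sec3Data.ofSec2 C τ).ZC m T)] : Prop :=
  ∀ a b : (Sec3Data.ofSec2 C τ).ZC m T,
    Nonempty (a ⟶ b) ↔ ∃ e : a.1 = b.1, Sec2Core.ZObj.Iso (e ▸ a.2) b.2

end Sec2Bridge

end Literature.AlgebraicGeometry.ShimuraVarieties.KudlaRapoport2013.Sec3ComplexUniformization

end
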